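import Mathlib
import Literature.MathematicalPhysics.QuantumLattice.WilsonDiracAP
import Literature.MathematicalPhysics.QuantumFieldTheory.ConstructiveQFTWave0Proofs
import Summits.QuantumFields.QCD.Theorems.QuarksAsStableActionDefs
import Summits.QuantumFields.QCD.Theorems.QuarksAsStableActionUnquenchedChessboardBoundStubMarginalRPChiral
import HarnessLib

/-!
# Link Gram identity, part 3: the block structure of a link-reflection-symmetric slab
(crux stmt-QuantumFields-9735, line `Sketch`, lead's stub `linkGram`)

For the link reflection `θ : t ↦ 1 - t` of the tree (`Site.timeReflect`) and a half-length `p`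
with `2p + 2 < L`, the UPPER sites are the slices `1 ≤ t ≤ p + 1` (`linkUpSites`), the LOWER ones
their mirror images `-p ≤ t ≤ 0` (`θx ∈ linkUpSites`). For a bond set `F` all of whose bonds join sites of
these two kinds, the bond-diluted Wilson–Dirac matrix (chiral basis, `r = 1`) is, after sorting the
indices into (mirrored upper) ⊕ (upper) ⊕ (rest), the block matrix
`[[P, J₁], [J₂, Q]] ⊕ (m+4)·1` (`linkP`, `linkJ₁`, `linkJ₂`, `linkQ`, all indexed by `Fin n` through
an enumeration of the upper indices): `det_bondWilsonDiracG_eq_linkBlocks`.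
All statements are proved.
-/

noncomputable section

open Matrix Complex Finset
open Literature.MathematicalPhysics.QuantumFieldTheory Literature.MathematicalPhysics.QuantumLattice
open Literature.Probability.LatticeModels
open Summit.QuantumFields.QCD.Theorems.QuarksAsStableAction
open scoped ComplexConjugate BigOperators

namespace Summit.QuantumFields.QCD.Theorems.UnquenchedChessboardBoundLine

/-! ## Upper and lower sites of the link reflection -/

section Sites

variable {L : ℕ} [NeZero L]

/-- The upper sites of a symmetric slab of half-length `p + 1` slices: `1 ≤ t ≤ p + 1`. -/
def linkUpSites (p : ℕ) : Finset (TorusSite 4 L) :=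
  univ.filter fun x => 1 ≤ (x 0).val ∧ (x 0).val ≤ p + 1

/-- Membership in `linkUpSites`. (The LOWER sites are the `x` with `θx ∈ linkUpSites p`.) -/
@[simp] theorem mem_linkUpSites {p : ℕ} {x : TorusSite 4 L} :
    x ∈ linkUpSites p ↔ 1 ≤ (x 0).val ∧ (x 0).val ≤ p + 1 := by
  simp [linkUpSites]

variable [Fact (1 < L)]

/-- Time of the mirror image of an upper site: `0` for `t = 1`, `L + 1 - t ≥ L - p` otherwise. -/
theorem val_timeReflect_of_mem_linkUpSites {p : ℕ} {x : TorusSite 4 L} (hx : x ∈ linkUpSites p) :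
    ((Site.timeReflect x) 0).val = if (x 0).val = 1 then 0 else L + 1 - (x 0).val := by
  rw [mem_linkUpSites] at hx
  rw [WilsonRP.val_timeReflect]
  have h1 := hx.1
  rw [if_neg (by omega)]

/-- Upper and lower sites are disjoint (`2p + 2 < L`). -/
theorem timeReflect_not_mem_of_mem_linkUpSites {p : ℕ} (hL : 2 * p + 2 < L) {x : TorusSite 4 L}
    (hx : x ∈ linkUpSites p) : Site.timeReflect x ∉ linkUpSites p := by
  intro h
  rw [mem_linkUpSites] at h
  have h2 := h.1
  have h3 := h.2
  rw [val_timeReflect_of_mem_linkUpSites hx] at h2 h3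
  have := (mem_linkUpSites.1 hx).2
  split_ifs at h2 h3 with h1
  · omega
  · omega

omit [Fact (1 < L)] in
/-- The mirror image of `θx` is upper iff `x` is. -/
theorem timeReflect_timeReflect_mem_iff {p : ℕ} {x : TorusSite 4 L} :
    Site.timeReflect (Site.timeReflect x) ∈ linkUpSites p ↔ x ∈ linkUpSites p := by
  rw [WilsonRP.timeReflect_timeReflect]

end Sites

/-! ## The block matrices -/

section Blocks

variable {L N : ℕ} [NeZero L] {G : Type*} [Group G] (ρ : G →* Matrix (Fin N) (Fin N) ℂ)

/-- The mirror on fermionic indices: sites by `θ`, colour and spin unchanged. -/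
def linkMirror (i : TorusSite 4 L × Fin N × Fin 4) : TorusSite 4 L × Fin N × Fin 4 :=
  (Site.timeReflect i.1, i.2.1, i.2.2)

omit [NeZero L] in
/-- The index mirror is an involution. -/
@[simp] theorem linkMirror_linkMirror (i : TorusSite 4 L × Fin N × Fin 4) :
    linkMirror (linkMirror i) = i := by
  simp [linkMirror, WilsonRP.timeReflect_timeReflect]

/-- The number of upper fermionic indices. -/
def linkUpCard (L N p : ℕ) [NeZero L] : ℕ :=
  Fintype.card {i : TorusSite 4 L × Fin N × Fin 4 // i.1 ∈ linkUpSites p}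

/-- An enumeration of the upper fermionic indices. -/
def linkUpEnum (L N p : ℕ) [NeZero L] :
    Fin (linkUpCard L N p) ≃ {i : TorusSite 4 L × Fin N × Fin 4 // i.1 ∈ linkUpSites p} :=
  (Fintype.equivFin _).symm

/-- The upper block `Q_F[W]`: the chiral-basis diluted operator between upper indices. -/
def linkQ (p : ℕ) (F : Finset (Edge 4 L)) (W : GaugeConfig 4 L G) (m : ℝ) :
    Matrix (Fin (linkUpCard L N p)) (Fin (linkUpCard L N p)) ℂ :=
  Matrix.of fun i j =>
    bondWilsonDiracG ρ chiralGamma F W m 1 (linkUpEnum L N p i).1 (linkUpEnum L N p j).1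

/-- The lower block `P_F[W]`, pulled back to the upper indices by the mirror. -/
def linkP (p : ℕ) (F : Finset (Edge 4 L)) (W : GaugeConfig 4 L G) (m : ℝ) :
    Matrix (Fin (linkUpCard L N p)) (Fin (linkUpCard L N p)) ℂ :=
  Matrix.of fun i j =>
    bondWilsonDiracG ρ chiralGamma F W m 1 (linkMirror (linkUpEnum L N p i).1)
      (linkMirror (linkUpEnum L N p j).1)

/-- The coupling block lower → upper indices (rows lower, columns upper). -/
def linkJ₁ (p : ℕ) (F : Finset (Edge 4 L)) (W : GaugeConfig 4 L G) (m : ℝ) :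
    Matrix (Fin (linkUpCard L N p)) (Fin (linkUpCard L N p)) ℂ :=
  Matrix.of fun i j =>
    bondWilsonDiracG ρ chiralGamma F W m 1 (linkMirror (linkUpEnum L N p i).1) (linkUpEnum L N p j).1

/-- The coupling block upper → lower indices (rows upper, columns lower). -/
def linkJ₂ (p : ℕ) (F : Finset (Edge 4 L)) (W : GaugeConfig 4 L G) (m : ℝ) :
    Matrix (Fin (linkUpCard L N p)) (Fin (linkUpCard L N p)) ℂ :=
  Matrix.of fun i j =>
    bondWilsonDiracG ρ chiralGamma F W m 1 (linkUpEnum L N p i).1 (linkMirror (linkUpEnum L N p j).1)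

/-! ## Sorting the indices: the block decomposition of the determinant -/

omit [NeZero L] in
/-- Entries of the diluted operator between an index inside and an index outside a set of sites
containing both endpoints of every bond vanish (off the diagonal). -/
theorem bondWilsonDiracG_apply_of_not_mem (γ : Fin 4 → Matrix (Fin 4) (Fin 4) ℂ)
    (F : Finset (Edge 4 L)) (T : TorusSite 4 L → Prop)
    (hT : ∀ b ∈ F, T b.1 ∧ T (Site.shift b.1 b.2)) (W : GaugeConfig 4 L G) (m r : ℝ)
    (a b : TorusSite 4 L × Fin N × Fin 4) (h : ¬ T a.1 ∨ ¬ T b.1) :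
    bondWilsonDiracG ρ γ F W m r a b = if a = b then ((m + 4 * r : ℝ) : ℂ) else 0 := by
  rw [bondWilsonDiracG_apply]
  have hsum : (∑ μ : Fin 4,
      ((if b.1 = Site.shift a.1 μ ∧ (a.1, μ) ∈ F then
          ((r : ℂ) • (1 : Matrix (Fin 4) (Fin 4) ℂ) - γ μ) a.2.2 b.2.2 * ρ (W (a.1, μ)) a.2.1 b.2.1
        else 0) +
        (if a.1 = Site.shift b.1 μ ∧ (b.1, μ) ∈ F then
          ((r : ℂ) • (1 : Matrix (Fin 4) (Fin 4) ℂ) + γ μ) a.2.2 b.2.2 * ρ (W (b.1, μ))⁻¹ a.2.1 b.2.1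
        else 0))) = 0 := by
    refine Finset.sum_eq_zero fun μ _ => ?_
    have hf : ¬ (b.1 = Site.shift a.1 μ ∧ (a.1, μ) ∈ F) := by
      rintro ⟨h1, h2⟩
      have ha := (hT _ h2).1
      have hb : T b.1 := h1 ▸ (hT _ h2).2
      exact h.elim (fun h' => h' ha) (fun h' => h' hb)
    have hb : ¬ (a.1 = Site.shift b.1 μ ∧ (b.1, μ) ∈ F) := by
      rintro ⟨h1, h2⟩
      have hb := (hT _ h2).1
      have ha : T a.1 := h1 ▸ (hT _ h2).2
      exact h.elim (fun h' => h' ha) (fun h' => h' hb)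
    rw [if_neg hf, if_neg hb, add_zero]
  rw [hsum, mul_zero, sub_zero]

variable [Fact (1 < L)]

/-- The sorting map of the indices: (mirrored upper) ⊕ (upper) ⊕ (rest) → all indices. -/
def linkSort (p : ℕ) :
    (Fin (linkUpCard L N p) ⊕ Fin (linkUpCard L N p)) ⊕
        {i : TorusSite 4 L × Fin N × Fin 4 // ¬ (i.1 ∈ linkUpSites p ∨ Site.timeReflect i.1 ∈ linkUpSites p)} →
      TorusSite 4 L × Fin N × Fin 4
  | Sum.inl (Sum.inl i) => linkMirror (linkUpEnum L N p i).1
  | Sum.inl (Sum.inr i) => (linkUpEnum L N p i).1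
  | Sum.inr k => k.1

/-- The sorting map is a bijection (`2p + 2 < L` makes upper and lower sites disjoint). -/
theorem linkSort_bijective (p : ℕ) (hL : 2 * p + 2 < L) :
    Function.Bijective (linkSort (L := L) (N := N) p) := by
  have hUL : ∀ {x : TorusSite 4 L}, x ∈ linkUpSites p → Site.timeReflect x ∉ linkUpSites p :=
    fun hx => timeReflect_not_mem_of_mem_linkUpSites hL hx
  constructor
  · rintro ((i | i) | k) ((j | j) | l) h <;> simp only [linkSort] at h
    · have := (linkUpEnum L N p).injective
        (Subtype.ext (by simpa using congrArg linkMirror h))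
      rw [this]
    · exfalso
      have hj := (linkUpEnum L N p j).2
      have hi : Site.timeReflect (linkUpEnum L N p j).1.1 ∈ linkUpSites p := by
        rw [← h]; exact timeReflect_timeReflect_mem_iff.2 (linkUpEnum L N p i).2
      exact hUL hj hi
    · exfalso
      apply l.2
      rw [← h]
      exact Or.inr (timeReflect_timeReflect_mem_iff.2 (linkUpEnum L N p i).2)
    · exfalso
      have hi := (linkUpEnum L N p i).2
      have hj : Site.timeReflect (linkUpEnum L N p i).1.1 ∈ linkUpSites p := by
        rw [h]; exact timeReflect_timeReflect_mem_iff.2 (linkUpEnum L N p j).2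
      exact hUL hi hj
    · rw [(linkUpEnum L N p).injective (Subtype.ext h)]
    · exfalso
      apply l.2
      rw [← h]
      exact Or.inl (linkUpEnum L N p i).2
    · exfalso
      apply k.2
      rw [h]
      exact Or.inr (timeReflect_timeReflect_mem_iff.2 (linkUpEnum L N p j).2)
    · exfalso
      apply k.2
      rw [h]
      exact Or.inl (linkUpEnum L N p j).2
    · rw [Subtype.ext h]
  · intro x
    by_cases hu : x.1 ∈ linkUpSites p
    · refine ⟨Sum.inl (Sum.inr ((linkUpEnum L N p).symm ⟨x, hu⟩)), ?_⟩
      simp [linkSort]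
    · by_cases hl : Site.timeReflect x.1 ∈ linkUpSites p
      · refine ⟨Sum.inl (Sum.inl ((linkUpEnum L N p).symm ⟨linkMirror x, hl⟩)), ?_⟩
        simp [linkSort]
      · exact ⟨Sum.inr ⟨x, fun h' => h'.elim hu hl⟩, rfl⟩

/-- The sorting equivalence. -/
def linkSortEquiv (p : ℕ) (hL : 2 * p + 2 < L) :
    (Fin (linkUpCard L N p) ⊕ Fin (linkUpCard L N p)) ⊕
        {i : TorusSite 4 L × Fin N × Fin 4 // ¬ (i.1 ∈ linkUpSites p ∨ Site.timeReflect i.1 ∈ linkUpSites p)} ≃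
      TorusSite 4 L × Fin N × Fin 4 :=
  Equiv.ofBijective _ (linkSort_bijective p hL)

/-- **The block decomposition.** If every bond of `F` joins upper/lower sites, then after
sorting, `D'_F[W] = [[P, J₁], [J₂, Q]] ⊕ (m + 4)·1`. -/
theorem bondWilsonDiracG_submatrix_linkSort (p : ℕ) (hL : 2 * p + 2 < L) (F : Finset (Edge 4 L))
    (hF : ∀ b ∈ F, (b.1 ∈ linkUpSites p ∨ Site.timeReflect b.1 ∈ linkUpSites p) ∧
      (b.1.shift b.2 ∈ linkUpSites p ∨ Site.timeReflect (b.1.shift b.2) ∈ linkUpSites p))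
    (W : GaugeConfig 4 L G) (m : ℝ) :
    (bondWilsonDiracG ρ chiralGamma F W m 1).submatrix (linkSortEquiv p hL) (linkSortEquiv p hL) =
      Matrix.fromBlocks
        (Matrix.fromBlocks (linkP ρ p F W m) (linkJ₁ ρ p F W m) (linkJ₂ ρ p F W m) (linkQ ρ p F W m))
        0 0 (((m + 4 * 1 : ℝ) : ℂ) • (1 : Matrix _ _ ℂ)) := by
  have hT := hF
  ext ((i | i) | k) ((j | j) | l)
  · simp [linkSortEquiv, linkSort, linkP]
  · simp [linkSortEquiv, linkSort, linkJ₁]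
  · simp only [Matrix.submatrix_apply, linkSortEquiv, Equiv.ofBijective_apply, linkSort,
      Matrix.fromBlocks_apply₁₂, Matrix.zero_apply]
    rw [bondWilsonDiracG_apply_of_not_mem ρ chiralGamma F
      (fun x => x ∈ linkUpSites p ∨ Site.timeReflect x ∈ linkUpSites p) hT W m 1 _ _ (Or.inr l.2), if_neg]
    intro h
    exact l.2 (h ▸ Or.inr (timeReflect_timeReflect_mem_iff.2 (linkUpEnum L N p i).2))
  · simp [linkSortEquiv, linkSort, linkJ₂]
  · simp [linkSortEquiv, linkSort, linkQ]
  · simp only [Matrix.submatrix_apply, linkSortEquiv, Equiv.ofBijective_apply, linkSort,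
      Matrix.fromBlocks_apply₁₂, Matrix.zero_apply]
    rw [bondWilsonDiracG_apply_of_not_mem ρ chiralGamma F
      (fun x => x ∈ linkUpSites p ∨ Site.timeReflect x ∈ linkUpSites p) hT W m 1 _ _ (Or.inr l.2), if_neg]
    intro h
    exact l.2 (h ▸ Or.inl (linkUpEnum L N p i).2)
  · simp only [Matrix.submatrix_apply, linkSortEquiv, Equiv.ofBijective_apply, linkSort,
      Matrix.fromBlocks_apply₂₁, Matrix.zero_apply]
    rw [bondWilsonDiracG_apply_of_not_mem ρ chiralGamma F
      (fun x => x ∈ linkUpSites p ∨ Site.timeReflect x ∈ linkUpSites p) hT W m 1 _ _ (Or.inl k.2), if_neg]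
    intro h
    exact k.2 (h ▸ Or.inr (timeReflect_timeReflect_mem_iff.2 (linkUpEnum L N p j).2))
  · simp only [Matrix.submatrix_apply, linkSortEquiv, Equiv.ofBijective_apply, linkSort,
      Matrix.fromBlocks_apply₂₁, Matrix.zero_apply]
    rw [bondWilsonDiracG_apply_of_not_mem ρ chiralGamma F
      (fun x => x ∈ linkUpSites p ∨ Site.timeReflect x ∈ linkUpSites p) hT W m 1 _ _ (Or.inl k.2), if_neg]
    intro h
    exact k.2 (h ▸ Or.inl (linkUpEnum L N p j).2)
  · simp only [Matrix.submatrix_apply, linkSortEquiv, Equiv.ofBijective_apply, linkSort,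
      Matrix.fromBlocks_apply₂₂, Matrix.smul_apply, Matrix.one_apply, smul_eq_mul]
    rw [bondWilsonDiracG_apply_of_not_mem ρ chiralGamma F
      (fun x => x ∈ linkUpSites p ∨ Site.timeReflect x ∈ linkUpSites p) hT W m 1 _ _ (Or.inl k.2)]
    by_cases h : k = l
    · subst h; simp
    · have h' : (k : TorusSite 4 L × Fin N × Fin 4) ≠ l := fun hh => h (Subtype.ext hh)
      simp [h, h']

/-- **The determinant in blocks**:
`det D'_F[W] = det [[P, J₁], [J₂, Q]] · (m + 4)^{#rest indices}`. -/
theorem det_bondWilsonDiracG_eq_linkBlocks (p : ℕ) (hL : 2 * p + 2 < L) (F : Finset (Edge 4 L))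
    (hF : ∀ b ∈ F, (b.1 ∈ linkUpSites p ∨ Site.timeReflect b.1 ∈ linkUpSites p) ∧
      (b.1.shift b.2 ∈ linkUpSites p ∨ Site.timeReflect (b.1.shift b.2) ∈ linkUpSites p))
    (W : GaugeConfig 4 L G) (m : ℝ) :
    (bondWilsonDiracG ρ chiralGamma F W m 1).det =
      (Matrix.fromBlocks (linkP ρ p F W m) (linkJ₁ ρ p F W m) (linkJ₂ ρ p F W m)
          (linkQ ρ p F W m)).det *
        ((m + 4 * 1 : ℝ) : ℂ) ^
          Fintype.card {i : TorusSite 4 L × Fin N × Fin 4 // ¬ (i.1 ∈ linkUpSites p ∨ Site.timeReflect i.1 ∈ linkUpSites p)} := by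
  rw [← Matrix.det_submatrix_equiv_self (linkSortEquiv p hL),
    bondWilsonDiracG_submatrix_linkSort ρ p hL F hF W m, Matrix.det_fromBlocks_zero₂₁, Matrix.det_smul,
    Matrix.det_one, mul_one, Fintype.card]

end Blocks

end Summit.QuantumFields.QCD.Theorems.UnquenchedChessboardBoundLine

end
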